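import Summits.QuantumFields.YangMills.Theorems.BalabanUVNodesN15CovariantAveragingTwoGrid
import HarnessLib

/-!
# Route «BalabanUVNodes», node N15 = NE2, road (c) — PROGRAMME (P-Q), IVb: THE TWO-GRID η-DEFECT OF THE ADJOINT AVERAGING SHAPE THROUGH KING's PAIRING —
# `Q′*_{W′} − P̂∘Q*_W` is `≤ (φ + 2B·η)·e^{ρ′}·e^{−ρ′d}` blockwise, `φ` the fit between each fine transport and its projected coarse partner,
# `B` the kernel size, `η = L^{−k}`: the multiplicities of the fine line over the coarse one match exactly except one boundary term per line (telescoping)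

Cell `pub-ymgap`, seat `pub-ymgap-dag-n15-c` (generation g21; R134 (a) seat, strategy s1; HUMAN RULING D-0062; chair R424 venue).  `bears_on: R4∕N15 · K3⁸ SpineGivenEndpointR13SepCoPHV
(stmt-QuantumFields-27366)`; filed `--supports stmt-QuantumFields-27366 --as helper` — COUNT-NEUTRAL.  THEOREMS only ([folklore] lattice combinatorics + block-majorant bookkeeping), 0 `def`,
0 `sorry`.  Imports BY NAME, nothing in the tree modified ∕ restated: n15-c∕184a `…CovariantAveragingTwoGrid` (`sum_range_mul_eq`, `kingPr_sub_mul_smul`, `blockOf_kingPr`, `kingPr_sub_smul_eq`), n15-c∕181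
`…CovariantAveragingObjects` (`qvAdjKer`, `qvAdjKer_apply`), n15-c∕182b (`one_le_exp_mul_exp_of_le_one`; through it
`…TwoGridLocality`: `tdistT_blockOf_add_smul_le`; `…TwoGridConsistency`: `kingPr_add_smul_unitVec_of_le`; `…TwoGridTransports`: `kingPr_add_smul_unitVec`), n15-a `kingPr`∕`kingPrV`∕`kingPr_val`,
n15-b `liftMap`∕`liftBlk`, King's `blockOf_over`, `card_fibre_blockOf`, the Literature's `HasMaj`∕`pull`∕`abs_le_loc_ofBlocks`∕`loc_ofBlocks_le`.

WHY.  FILE 123 (`uN_idef_cvGlued`) asks, besides the one-grid letters of `N_V` (n15-c∕182b∕183), for its TWO-GRID defect row `hDNV`: `𝔇(N_V′, N_V) = N_V′∘P̂ − P̂∘N_V ≤ o_N e^{−δd}` with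
`o_N` an η-RATE letter (`P̂ = pull (liftMap kingPrV ι)` King's piecewise-constant prolongation).  With `N_V^Q = a(Q*Q ⊗ 1 − Q*(U)Q(U))` and Leibniz
(`Q′*Q′P̂ − P̂Q*Q = Q′*(Q′P̂ − Q) + (Q′* − P̂Q*)Q`, both grids sharing the unit lattice) everything reduces to the two defects of THIS file for the covariant shapes (the flat ones are
dag-n15-a parts 35–37).  THE MECHANISM (one level of [Balaban1985BackgroundPropagators] (3.73)∕King's Prop. 3.9 bookkeeping for an `x`-DEPENDENT matrix kernel): write the fine line
index `s′ = L^m s + j` (`s < L^k`, `j < L^m`) and the fine block points over the coarse ones (`(L^m)^{d+1}` each, King's `card_fibre`); the fine bond point `x′ + s′e′` projects to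
`πx′ + (s + δ)e` with `δ = δ(x′, j) ∈ {0, 1}` (`kingPr_add_smul_unitVec_of_le`); partner the fine term `(x′, s′)` with the coarse term `(πx′, s + δ)`: the kernels differ by the FIT
`φ` (hypothesis; the sequel produces it from this seat's g4 `norm_stairProd_two_spacing_le`), and the re-indexed coarse terms `s ↦ s + δ` TELESCOPE against the original ones
(`Finset.sum_range_sub`), leaving one boundary term `g(L^k) − g(0)` of size `2B` per `(x′, j)` with `δ = 1` — weight `L^m∕(L^mL^k) = η` after averaging.  Same for the adjoint
shape with columns, the borrow `δ′` of `π(x′ − je′)` and the block identity `B′(p′) = B(πp′)` (`blockOf_over`).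

RESULTS ([folklore]; (1.18)∕(3.73) tags mark shapes, nothing printed is asserted).
* §3 ★★ **`hasMaj_qvAdjKer_twoGrid`**: column size∕fit (partner `(π(x′) − (s + δ′)e, s + δ′)` for the fine `(x′ − s′e′, s′)`, `π(x′ − je′) = πx′ − δ′e`) ⟹
  `Q′*_{W′} − P̂∘Q*_W ≤ (φ + 2B∕L^k)·e^{ρ′}·e^{−ρ′|y−y′|_T}` (unit-lattice forms → fine coloured 1-forms blocked by the unit block of their projection).

HONEST FRAMING ∕ LIMITS.  Generic lattice bookkeeping for the MODEL shapes of n15-c∕181 (arbitrary matrix path kernels `W`, `W′`); the fits `φ` are HYPOTHESES here (the sequel: transport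
fits of `cvaPath` at two spacings from the (3.35) letters); no estimate of Bałaban's; one pairing level (King's `⌊·∕L^m⌋`).  NE2⁺ NOT PRINTED; N15 of record untouched (DISCHARGED AS
CONSUMED); counts UNMOVED (typed 28∕28); one finite 𝕋⁴ at fixed ε per index — NOT infinite volume ∕ OS ∕ mass gap ∕ Clay.  Restate-immune (no Theses import).
-/

noncomputable section

open scoped BigOperators Matrix
open Finset

namespace Summit.QuantumFields.YangMills.BalabanUVNodes.N15.CovAvg

open Literature.MathematicalPhysics.QuantumFieldTheory.Balaban1983to89
open Literature.MathematicalPhysics.QuantumFieldTheory.Balaban1983to89.B11SectG (BlockNorm HasMaj)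
open Literature.MathematicalPhysics.QuantumFieldTheory.Balaban1983to89.B11AxialTransport190 (abs_le_loc_ofBlocks loc_ofBlocks_le)
open Literature.MathematicalPhysics.QuantumFieldTheory.Balaban1983to89.B5Prop11Plancherel (Tor fine unitVec)
open Literature.MathematicalPhysics.QuantumFieldTheory.Balaban1983to89.B6UnitTorusCarrier (unitTorusGeo card_fibre_blockOf)
open Literature.MathematicalPhysics.QuantumFieldTheory.Balaban1983to89.T4EtaRateCoeffDefect (pull pull_apply fibre mem_fibre)
open Literature.MathematicalPhysics.QuantumFieldTheory.King1986.Torus (blockOf val_blockOf blockOf_over tdistT tdistT_nonneg tdistT_symm)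
open Summit.QuantumFields.YangMills.BalabanUVNodes.N15.VectorPiece (kingPr kingPrV kingPr_val kingPrV_eq)
open Summit.QuantumFields.YangMills.BalabanUVNodes.N15.MatrixSpecies (liftMap liftBlk)
open Summit.QuantumFields.YangMills.BalabanUVNodes.N15.DefectKernel (card_fibre_kingProj)
open Summit.QuantumFields.YangMills.BalabanUVNodes.N15.TwoGrid (tdistT_blockOf_add_smul_le kingPr_add_smul_unitVec kingPr_add_smul_unitVec_of_le)

variable {d : ℕ}

/-! ## §3 The two-grid defect of the adjoint shape -/

section Adjoint

variable {L : ℕ} [NeZero L] (M : Fin (d + 1) → ℕ) [∀ μ, NeZero (M μ)] (k m : ℕ) {ι : Type} [Fintype ι]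

/-- THE DIFFERENCE OF THE ADJOINT SHAPES, TERM BY TERM over `(s, j)`: `(Q′*_{W′}v − P̂Q*_Wv)((x′, κ), c) = n′⁻¹ Σ_{s<L^k} Σ_{j<L^m} [Σ_i W′(x′ − s′e′, κ)(s′)_{ic} v(B′(x′ − s′e′), κ, i) −
Σ_i W(πx′ − se, κ)(s)_{ic} v(B(πx′ − se), κ, i)]`, `s′ = L^ms + j`. [folklore] -/
theorem qvAdjKer_twoGrid_sub_apply (W' : Tor (fine (L ^ m * L ^ k) M) × Fin (d + 1) → ℕ → Matrix ι ι ℝ) (W : Tor (fine (L ^ k) M) × Fin (d + 1) → ℕ → Matrix ι ι ℝ)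
    (v : (Tor M × Fin (d + 1)) × ι → ℝ) (p : (Tor (fine (L ^ m * L ^ k) M) × Fin (d + 1)) × ι) :
    (qvAdjKer M (L ^ m * L ^ k) W' - pull (liftMap (kingPrV L k m M) ι) ∘ₗ qvAdjKer M (L ^ k) W) v p =
      (((L ^ m * L ^ k : ℕ) : ℝ))⁻¹ * ∑ s ∈ range (L ^ k), ∑ j ∈ range (L ^ m),
        (∑ i, W' (p.1.1 - (L ^ m * s + j) • unitVec (fine (L ^ m * L ^ k) M) p.1.2, p.1.2) (L ^ m * s + j) i p.2 *
            v ((blockOf (L ^ m * L ^ k) M (p.1.1 - (L ^ m * s + j) • unitVec (fine (L ^ m * L ^ k) M) p.1.2), p.1.2), i) -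
          ∑ i, W (kingPr L k m M p.1.1 - s • unitVec (fine (L ^ k) M) p.1.2, p.1.2) s i p.2 *
            v ((blockOf (L ^ k) M (kingPr L k m M p.1.1 - s • unitVec (fine (L ^ k) M) p.1.2), p.1.2), i)) := by
  have hL : (L : ℝ) ≠ 0 := Nat.cast_ne_zero.mpr (NeZero.ne L)
  have hc2 : (((L ^ m * L ^ k : ℕ) : ℝ))⁻¹ * ((L ^ m : ℕ) : ℝ) = (((L ^ k : ℕ) : ℝ))⁻¹ := by
    have h1 : (L : ℝ) ^ m ≠ 0 := by positivity
    push_cast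
    rw [mul_inv, mul_assoc, mul_comm ((L : ℝ) ^ k)⁻¹, ← mul_assoc, inv_mul_cancel₀ h1, one_mul]
  rw [LinearMap.sub_apply, LinearMap.comp_apply, Pi.sub_apply, pull_apply, qvAdjKer_apply, qvAdjKer_apply]
  -- fine side: re-index the line; coarse side: insert the digit sum
  rw [sum_range_mul_eq (fun s' => ∑ i, W' (p.1.1 - s' • unitVec (fine (L ^ m * L ^ k) M) p.1.2, p.1.2) s' i p.2 *
    v ((blockOf (L ^ m * L ^ k) M (p.1.1 - s' • unitVec (fine (L ^ m * L ^ k) M) p.1.2), p.1.2), i)) (L ^ m) (L ^ k)]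
  have hin : ∀ s ∈ range (L ^ k), ∑ _j ∈ range (L ^ m), ∑ i, W (kingPr L k m M p.1.1 - s • unitVec (fine (L ^ k) M) p.1.2, p.1.2) s i p.2 *
        v ((blockOf (L ^ k) M (kingPr L k m M p.1.1 - s • unitVec (fine (L ^ k) M) p.1.2), p.1.2), i) =
      ((L ^ m : ℕ) : ℝ) * ∑ i, W (kingPr L k m M p.1.1 - s • unitVec (fine (L ^ k) M) p.1.2, p.1.2) s i p.2 *
        v ((blockOf (L ^ k) M (kingPr L k m M p.1.1 - s • unitVec (fine (L ^ k) M) p.1.2), p.1.2), i) := fun s _ => by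
    rw [sum_const, card_range, nsmul_eq_mul]
  have hco : (((L ^ k : ℕ) : ℝ))⁻¹ * ∑ s ∈ range (L ^ k), ∑ i, W (kingPr L k m M p.1.1 - s • unitVec (fine (L ^ k) M) p.1.2, p.1.2) s i p.2 *
        v ((blockOf (L ^ k) M (kingPr L k m M p.1.1 - s • unitVec (fine (L ^ k) M) p.1.2), p.1.2), i) =
      (((L ^ m * L ^ k : ℕ) : ℝ))⁻¹ * ∑ s ∈ range (L ^ k), ∑ _j ∈ range (L ^ m), ∑ i, W (kingPr L k m M p.1.1 - s • unitVec (fine (L ^ k) M) p.1.2, p.1.2) s i p.2 *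
        v ((blockOf (L ^ k) M (kingPr L k m M p.1.1 - s • unitVec (fine (L ^ k) M) p.1.2), p.1.2), i) := by
    rw [sum_congr rfl hin, ← mul_sum, ← mul_assoc, hc2]
  rw [show (liftMap (kingPrV L k m M) ι p) = ((kingPr L k m M p.1.1, p.1.2), p.2) from rfl]
  dsimp only
  rw [hco, ← mul_sub, ← sum_sub_distrib]
  refine congrArg _ (sum_congr rfl fun s _ => ?_)
  rw [← sum_sub_distrib]

/-- ★★ **THE TWO-GRID η-DEFECT OF THE ADJOINT SHAPE**: a coarse kernel `W` with columns `≤ B` (`s ≤ L^k`) and a fine kernel `W′` FITTING its projected coarse partner in columns —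
`Σ_i |(W′(x′ − s′e′_κ, κ)(s′) − W(πx′ − (s + δ′)e_κ, κ)(s + δ′))_{ic}| ≤ φ` whenever `π(x′ − je′_κ) = πx′ − δ′e_κ`, `δ′ ≤ 1`, `s′ = L^ms + j`, `s < L^k`, `j < L^m` — give
`Q′*_{W′} − P̂∘Q*_W ≤ (φ + 2B∕L^k)·e^{ρ′}·e^{−ρ′|y−y′|_T}` from unit-lattice coloured 1-forms into fine ones (blocked by their unit block), every `ρ′ ≥ 0`.
[cite: King1986, Prop. 3.9 (3.73) p.665 (shape); Balaban1984PropagatorsI, (1.18) p.20, (1.69) p.29 («Q*»)] -/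
theorem hasMaj_qvAdjKer_twoGrid {W' : Tor (fine (L ^ m * L ^ k) M) × Fin (d + 1) → ℕ → Matrix ι ι ℝ} {W : Tor (fine (L ^ k) M) × Fin (d + 1) → ℕ → Matrix ι ι ℝ}
    {B φ ρ' : ℝ} (hB : 0 ≤ B) (hφ : 0 ≤ φ) (hρ' : 0 ≤ ρ')
    (hW : ∀ p s, s ≤ L ^ k → ∀ c, ∑ i, |W p s i c| ≤ B)
    (hfit : ∀ (x' : Tor (fine (L ^ m * L ^ k) M)) (κ : Fin (d + 1)) (s j δ : ℕ), s < L ^ k → j < L ^ m → δ ≤ 1 →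
      kingPr L k m M (x' - j • unitVec (fine (L ^ m * L ^ k) M) κ) = kingPr L k m M x' - δ • unitVec (fine (L ^ k) M) κ →
      ∀ c, ∑ i, |(W' (x' - (L ^ m * s + j) • unitVec (fine (L ^ m * L ^ k) M) κ, κ) (L ^ m * s + j) -
        W (kingPr L k m M x' - (s + δ) • unitVec (fine (L ^ k) M) κ, κ) (s + δ)) i c| ≤ φ) :
    HasMaj (BlockNorm.ofBlocks (unitTorusGeo L k M) (liftBlk (fun b : Tor M × Fin (d + 1) => b.1) ι))
      (BlockNorm.ofBlocks (unitTorusGeo L k M) (liftBlk (fun b : Tor (fine (L ^ m * L ^ k) M) × Fin (d + 1) => blockOf (L ^ m * L ^ k) M b.1) ι))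
      (qvAdjKer M (L ^ m * L ^ k) W' - pull (liftMap (kingPrV L k m M) ι) ∘ₗ qvAdjKer M (L ^ k) W)
      (fun y y' => (φ + 2 * B / (L ^ k : ℕ)) * Real.exp ρ' * Real.exp (-(ρ' * tdistT M y y'))) := by
  classical
  intro y₁ v hv y
  set b₁ := (BlockNorm.ofBlocks (unitTorusGeo L k M) (liftBlk (fun b : Tor M × Fin (d + 1) => b.1) ι)).loc y₁ v with hb₁
  have hU0 : 0 ≤ b₁ := BlockNorm.loc_nonneg _ _ _
  have hn : (0 : ℝ) < ((L ^ k : ℕ) : ℝ) := by exact_mod_cast pow_pos (Nat.pos_of_ne_zero (NeZero.ne L)) k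
  have hn' : (0 : ℝ) < ((L ^ m * L ^ k : ℕ) : ℝ) := by exact_mod_cast Nat.mul_pos (pow_pos (Nat.pos_of_ne_zero (NeZero.ne L)) m) (pow_pos (Nat.pos_of_ne_zero (NeZero.ne L)) k)
  have hK0 : 0 ≤ (φ + 2 * B / (L ^ k : ℕ)) * Real.exp ρ' * Real.exp (-(ρ' * tdistT M y y₁)) := by positivity
  refine loc_ofBlocks_le _ _ (mul_nonneg hK0 hU0) fun p hp => ?_
  obtain ⟨⟨x', κ⟩, c⟩ := p
  change blockOf (L ^ m * L ^ k) M x' = y at hp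
  have hvb : ∀ q : (Tor M × Fin (d + 1)) × ι, |v q| ≤ (if q.1.1 = y₁ then b₁ else 0) := fun q => by
    split_ifs with hq
    · exact abs_le_loc_ofBlocks (g := unitTorusGeo L k M) (liftBlk (fun b : Tor M × Fin (d + 1) => b.1) ι) v hq
    · rw [hv q (by simpa [liftBlk] using hq), abs_zero]
  rw [qvAdjKer_twoGrid_sub_apply M k m]
  dsimp only
  set x₀ := kingPr L k m M x' with hx₀
  have hx₀y : blockOf (L ^ k) M x₀ = y := by rw [hx₀, blockOf_kingPr]; exact hp
  -- the value of the input at the block of `x₀ − t e`, `t ≤ L^k`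
  have hval : ∀ t : ℕ, t ≤ L ^ k → ∀ i, |v ((blockOf (L ^ k) M (x₀ - t • unitVec (fine (L ^ k) M) κ), κ), i)| ≤ Real.exp ρ' * Real.exp (-(ρ' * tdistT M y y₁)) * b₁ :=
    fun t ht i => by
    refine (hvb _).trans ?_
    split_ifs with hq
    · have hd : tdistT M y y₁ ≤ 1 := by
        have h := tdistT_blockOf_add_smul_le M (L ^ k) (x₀ - t • unitVec (fine (L ^ k) M) κ) κ ht
        rw [sub_add_cancel, hx₀y] at h
        change blockOf (L ^ k) M (x₀ - t • unitVec (fine (L ^ k) M) κ) = y₁ at hq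
        rwa [hq] at h
      exact le_mul_of_one_le_left hU0 (one_le_exp_mul_exp_of_le_one hρ' hd)
    · positivity
  -- per digit `j`: fit + telescoping
  have hline : ∀ j ∈ range (L ^ m),
      |∑ s ∈ range (L ^ k), (∑ i, W' (x' - (L ^ m * s + j) • unitVec (fine (L ^ m * L ^ k) M) κ, κ) (L ^ m * s + j) i c *
            v ((blockOf (L ^ m * L ^ k) M (x' - (L ^ m * s + j) • unitVec (fine (L ^ m * L ^ k) M) κ), κ), i) -
          ∑ i, W (x₀ - s • unitVec (fine (L ^ k) M) κ, κ) s i c * v ((blockOf (L ^ k) M (x₀ - s • unitVec (fine (L ^ k) M) κ), κ), i))| ≤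
      ((L ^ k : ℕ) : ℝ) * φ * (Real.exp ρ' * Real.exp (-(ρ' * tdistT M y y₁)) * b₁) + 2 * B * (Real.exp ρ' * Real.exp (-(ρ' * tdistT M y y₁)) * b₁) := by
    intro j hj
    have hjL : j ≤ L ^ m := (mem_range.mp hj).le
    obtain ⟨δ, hδ1, hδ⟩ := kingPr_sub_smul_eq M L k m x' κ hjL
    -- the fine source blocks are the coarse blocks of `x₀ − (s + δ)e`
    have hblk : ∀ s : ℕ, blockOf (L ^ m * L ^ k) M (x' - (L ^ m * s + j) • unitVec (fine (L ^ m * L ^ k) M) κ) =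
        blockOf (L ^ k) M (x₀ - (s + δ) • unitVec (fine (L ^ k) M) κ) := fun s => by
      rw [← blockOf_kingPr M L k m, add_smul, add_comm ((L ^ m * s) • _), sub_add_eq_sub_sub, kingPr_sub_mul_smul, hδ, hx₀, sub_sub, ← add_smul, add_comm δ s]
    set g : ℕ → ℝ := fun t => ∑ i, W (x₀ - t • unitVec (fine (L ^ k) M) κ, κ) t i c * v ((blockOf (L ^ k) M (x₀ - t • unitVec (fine (L ^ k) M) κ), κ), i) with hg
    have hgb : ∀ t, t ≤ L ^ k → |g t| ≤ B * (Real.exp ρ' * Real.exp (-(ρ' * tdistT M y y₁)) * b₁) := fun t ht => by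
      calc |g t| ≤ ∑ i, |W (x₀ - t • unitVec (fine (L ^ k) M) κ, κ) t i c| * |v ((blockOf (L ^ k) M (x₀ - t • unitVec (fine (L ^ k) M) κ), κ), i)| :=
            (abs_sum_le_sum_abs _ _).trans (le_of_eq (sum_congr rfl fun i _ => abs_mul _ _))
        _ ≤ ∑ i, |W (x₀ - t • unitVec (fine (L ^ k) M) κ, κ) t i c| * (Real.exp ρ' * Real.exp (-(ρ' * tdistT M y y₁)) * b₁) :=
            sum_le_sum fun i _ => mul_le_mul_of_nonneg_left (hval t ht i) (abs_nonneg _)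
        _ ≤ B * (Real.exp ρ' * Real.exp (-(ρ' * tdistT M y y₁)) * b₁) := by
            rw [← sum_mul]; exact mul_le_mul_of_nonneg_right (hW _ t ht c) (by positivity)
    have hsplit : ∀ s ∈ range (L ^ k),
        (∑ i, W' (x' - (L ^ m * s + j) • unitVec (fine (L ^ m * L ^ k) M) κ, κ) (L ^ m * s + j) i c *
            v ((blockOf (L ^ m * L ^ k) M (x' - (L ^ m * s + j) • unitVec (fine (L ^ m * L ^ k) M) κ), κ), i) -
          ∑ i, W (x₀ - s • unitVec (fine (L ^ k) M) κ, κ) s i c * v ((blockOf (L ^ k) M (x₀ - s • unitVec (fine (L ^ k) M) κ), κ), i)) =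
        (∑ i, (W' (x' - (L ^ m * s + j) • unitVec (fine (L ^ m * L ^ k) M) κ, κ) (L ^ m * s + j) - W (x₀ - (s + δ) • unitVec (fine (L ^ k) M) κ, κ) (s + δ)) i c *
            v ((blockOf (L ^ k) M (x₀ - (s + δ) • unitVec (fine (L ^ k) M) κ), κ), i)) + (g (s + δ) - g s) := by
      intro s _
      rw [hblk s, hg]
      simp only [Matrix.sub_apply, sub_mul, sum_sub_distrib]
      ring
    rw [sum_congr rfl hsplit, sum_add_distrib]
    have hfitS : |∑ s ∈ range (L ^ k), ∑ i, (W' (x' - (L ^ m * s + j) • unitVec (fine (L ^ m * L ^ k) M) κ, κ) (L ^ m * s + j) -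
        W (x₀ - (s + δ) • unitVec (fine (L ^ k) M) κ, κ) (s + δ)) i c * v ((blockOf (L ^ k) M (x₀ - (s + δ) • unitVec (fine (L ^ k) M) κ), κ), i)| ≤
        ((L ^ k : ℕ) : ℝ) * φ * (Real.exp ρ' * Real.exp (-(ρ' * tdistT M y y₁)) * b₁) := by
      calc _ ≤ ∑ s ∈ range (L ^ k), |∑ i, (W' (x' - (L ^ m * s + j) • unitVec (fine (L ^ m * L ^ k) M) κ, κ) (L ^ m * s + j) -
            W (x₀ - (s + δ) • unitVec (fine (L ^ k) M) κ, κ) (s + δ)) i c * v ((blockOf (L ^ k) M (x₀ - (s + δ) • unitVec (fine (L ^ k) M) κ), κ), i)| :=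
            abs_sum_le_sum_abs _ _
        _ ≤ ∑ _s ∈ range (L ^ k), φ * (Real.exp ρ' * Real.exp (-(ρ' * tdistT M y y₁)) * b₁) := sum_le_sum fun s hs => by
            have hsn : s < L ^ k := mem_range.mp hs
            calc _ ≤ ∑ i, |(W' (x' - (L ^ m * s + j) • unitVec (fine (L ^ m * L ^ k) M) κ, κ) (L ^ m * s + j) -
                  W (x₀ - (s + δ) • unitVec (fine (L ^ k) M) κ, κ) (s + δ)) i c| * |v ((blockOf (L ^ k) M (x₀ - (s + δ) • unitVec (fine (L ^ k) M) κ), κ), i)| :=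
                  (abs_sum_le_sum_abs _ _).trans (le_of_eq (sum_congr rfl fun i _ => abs_mul _ _))
              _ ≤ ∑ i, |(W' (x' - (L ^ m * s + j) • unitVec (fine (L ^ m * L ^ k) M) κ, κ) (L ^ m * s + j) -
                  W (x₀ - (s + δ) • unitVec (fine (L ^ k) M) κ, κ) (s + δ)) i c| * (Real.exp ρ' * Real.exp (-(ρ' * tdistT M y y₁)) * b₁) :=
                  sum_le_sum fun i _ => mul_le_mul_of_nonneg_left (hval (s + δ) (by omega) i) (abs_nonneg _)
              _ ≤ φ * (Real.exp ρ' * Real.exp (-(ρ' * tdistT M y y₁)) * b₁) := by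
                  rw [← sum_mul]
                  exact mul_le_mul_of_nonneg_right (hfit x' κ s j δ hsn (mem_range.mp hj) hδ1 hδ c) (by positivity)
        _ = _ := by rw [sum_const, card_range, nsmul_eq_mul]; ring
    have htel : |∑ s ∈ range (L ^ k), (g (s + δ) - g s)| ≤ 2 * B * (Real.exp ρ' * Real.exp (-(ρ' * tdistT M y y₁)) * b₁) := by
      interval_cases δ
      · simp only [add_zero, sub_self, sum_const_zero, abs_zero]; positivity
      · rw [sum_range_sub]
        calc |g (L ^ k) - g 0| ≤ |g (L ^ k)| + |g 0| := abs_sub _ _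
          _ ≤ B * _ + B * _ := add_le_add (hgb _ le_rfl) (hgb 0 (Nat.zero_le _))
          _ = _ := by ring
    exact (abs_add_le _ _).trans (add_le_add hfitS htel)
  rw [sum_comm, abs_mul, abs_inv, abs_of_pos hn']
  calc (((L ^ m * L ^ k : ℕ) : ℝ))⁻¹ * |∑ j ∈ range (L ^ m), ∑ s ∈ range (L ^ k), _|
      ≤ (((L ^ m * L ^ k : ℕ) : ℝ))⁻¹ * ∑ j ∈ range (L ^ m), (((L ^ k : ℕ) : ℝ) * φ * (Real.exp ρ' * Real.exp (-(ρ' * tdistT M y y₁)) * b₁) +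
          2 * B * (Real.exp ρ' * Real.exp (-(ρ' * tdistT M y y₁)) * b₁)) :=
        mul_le_mul_of_nonneg_left ((abs_sum_le_sum_abs _ _).trans (sum_le_sum fun j hj => hline j hj)) (by positivity)
    _ = (φ + 2 * B / (L ^ k : ℕ)) * Real.exp ρ' * Real.exp (-(ρ' * tdistT M y y₁)) * b₁ := by
        have hL0 : (L : ℝ) ≠ 0 := Nat.cast_ne_zero.mpr (NeZero.ne L)
        rw [sum_const, card_range, nsmul_eq_mul]
        push_cast
        field_simp

end Adjoint

end Summit.QuantumFields.YangMills.BalabanUVNodes.N15.CovAvg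

end
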